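import Summits.ValiantsHypothesis.ValiantsHypothesis.Theorems.BarrierLeverAnchoredDoorHitsLowerPairsLTCertificate
import Summits.ValiantsHypothesis.ValiantsHypothesis.Theorems.BarrierLeverAnchoredDoorHitsLowerPairsRelApexRecursion

/-!
# Support item `AnchoredDoorHitsLowerPairs` (stmt-ValiantsHypothesis-22510), line `anchored-peeling`:
# THE LT REST — the registered residual `Stmt.stub_relApexRest` minus the LT-certifiable pairs, with the kernel arrows

Helper file (`--supports stmt-ValiantsHypothesis-22510`; cell valiant-natproofs, rung V4, 𝒟-side door (c); registered line
`Cruxes/AnchoredDoorHitsLowerPairs/Lines/anchored_peeling.lean` v18 (registry {vertexStep, lefStep, crossed, sr, moveThinResidual, conjM, relApexRest});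
prover seat val-np-p1 gen 22; memo HOME/val-np-p1/g22/MEMO-relapex-valnp1-g22.md §4–§7; planner ask (A) of STATUS 2026-08-28T15:24:35Z). Closes NO item.

WHY. On the count-rigid members of the residual (narrow rows against ball-like wide columns, e.g. `(R₃, K₇)` = cube₅ minus three top faces against the
complete graph on 7 vertices) NO relative typed apex split exists (exhaustive search, memo §4) while an LT CERTIFICATE — 0/1 door supports whose support matrix
has a unique perfect matching, `LTCert` of `…LTCertificate` (p634984) — does exist (SAT, kit j311123/j311444). LT certificates are characteristic-free
M-instances (`conjM_pair_of_ltCert`), hence profile-1 hits (`symbolicDet_one_ne_zero_of_ltCert`, via the `ψ = 0` member: `symbolicDet_one_ne_zero_of_doorDet`).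

* `symbolicDet_one_ne_zero_of_doorDet` — ANY door configuration with nonzero layout determinant gives `symbolicDet 1 ≠ 0` (the evaluation argument of
  `symbolicDet_one_ne_zero_of_conjM`, stated once for all instance sources: Conjecture M, apex recursion, LT / future weighted certificates).
* `symbolicDet_one_ne_zero_of_ltCert`.
* `Stmt.stub_ltRest` — **STUB TEXT (offered): the relative apex rest MINUS the LT-certifiable pairs (either orientation)** — with
  `stub_relApexRest_of_ltRest : Stmt.stub_ltRest → Stmt.stub_relApexRest` (kernel narrowing of the registered residual) and
  `anchoredDoorHitsLowerPairs_of_ltRest` (route decl BY NAME).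

WHAT THIS IS NOT: `Stmt.stub_ltRest` is OPEN and not known to be census-empty (LT certificates are known for every tested pair with ≤ 6 row variables, memo §3,
but no infinite residual family is certified yet); nothing on crux stmt-ValiantsHypothesis-14610 or on `VP` versus `VNP`.
-/

set_option linter.dupNamespace false

namespace Summit.ValiantsHypothesis.ValiantsHypothesis.Theorems.BarrierLever.AnchoredPeeling

open Finset MvPolynomial
open Summit.ValiantsHypothesis.ValiantsHypothesis.Theorems.BarrierLever.BrickCalculus (pexpo pexpo_def pexpo_le_iff pexpo_sub
  pexpo_apply_castAdd pexpo_apply_natAdd)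

noncomputable section

variable {h : ℕ}

/-- **Any door configuration with nonzero layout determinant gives a profile-1 hit** (the `ψ = 0` member of 𝔄₁ evaluates the symbolic minor to it). -/
theorem symbolicDet_one_ne_zero_of_doorDet {r : ℕ} (u w : Fin r → Finset (Fin h))
    (hex : ∃ (θ : Fin h → Fin h → ℂ) (φ : Fin h → Fin h → Fin h → ℂ),
      (Matrix.of fun i j : Fin r => coeff (pexpo (u i) ∅) (∏ γ ∈ w j, doorElem θ φ γ)).det ≠ 0) :
    symbolicDet 1 h r u w ≠ 0 := by
  classical
  obtain ⟨θ, φ, hdet⟩ := hex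
  intro h0
  have hmap := congrArg (eval (mPoint θ φ)) h0
  rw [map_zero, symbolicDet, RingHom.map_det] at hmap
  apply hdet
  rw [← hmap]
  congr 1
  refine Matrix.ext (fun i j => ?_)
  rw [RingHom.mapMatrix_apply, Matrix.map_apply, Matrix.of_apply, Matrix.of_apply, ← pexpo_def, ← coeff_map, map_mPoint_symbolicWitness,
    coeff_prod_cpart θ φ Finset.univ (u i) (w j) (Finset.subset_univ _)]

/-- **An LT certificate gives a profile-1 hit.** -/
theorem symbolicDet_one_ne_zero_of_ltCert {r : ℕ} (u w : Fin r → Finset (Fin h)) (hc : LTCert u w) : symbolicDet 1 h r u w ≠ 0 :=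
  symbolicDet_one_ne_zero_of_doorDet u w (conjM_pair_of_ltCert u w hc)

/-- **STUB TEXT (offered): THE LT REST.** At some fixed profile `s ≥ 1` and all `h ≥ h₀`: every injective simplicial-complex pair with `r ≥ 2` rows, NO face-UQ
data on either side, which is not a relative apex pair in either orientation AND admits no LT certificate in either orientation, has nonzero symbolic minor. -/
def Stmt.stub_ltRest : Prop :=
  ∃ s h₀ : ℕ, 1 ≤ s ∧ ∀ h : ℕ, h₀ ≤ h → ∀ (r : ℕ) (u w : Fin r → Finset (Fin h)),
    Function.Injective u → Function.Injective w → IsLowerSet (Set.range u) → IsLowerSet (Set.range w) → 2 ≤ r →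
    (∀ (a : Fin h) (W₀ : Finset (Fin h)) (𝒜 : Finset (Finset (Fin h))) (ρ : Finset (Fin h) → Finset (Fin h)), ¬ UQFData s u w a W₀ 𝒜 ρ) →
    (∀ (c : Fin h) (Z : Finset (Fin h)) (𝒜 : Finset (Finset (Fin h))) (ρ : Finset (Fin h) → Finset (Fin h)), ¬ UQFData s w u c Z 𝒜 ρ) →
    ¬ IsRelApexPair u w → ¬ IsRelApexPair w u → ¬ LTCert u w → ¬ LTCert w u →
    symbolicDet s h r u w ≠ 0

/-- **Kernel narrowing of the registered residual: LT rest ⟹ `Stmt.stub_relApexRest`.** -/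
theorem stub_relApexRest_of_ltRest (hR : Stmt.stub_ltRest) : Stmt.stub_relApexRest := by
  obtain ⟨s, h₀, hs, hR⟩ := hR
  refine ⟨s, h₀, hs, fun h hh r u w hu hw hlu hlw hr hx hy hax hay => ?_⟩
  by_cases hcx : LTCert u w
  · exact symbolicDet_ne_zero_mono hs (symbolicDet_one_ne_zero_of_ltCert u w hcx)
  · by_cases hcy : LTCert w u
    · exact (symbolicDet_ne_zero_comm s h r u w).mpr (symbolicDet_ne_zero_mono hs (symbolicDet_one_ne_zero_of_ltCert w u hcy))
    · exact hR h hh r u w hu hw hlu hlw hr hx hy hax hay hcx hcy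

/-- **Composition BY NAME: LT rest ⟹ the support item `AnchoredDoorHitsLowerPairs`** (through the registered `Stmt.stub_relApexRest`). -/
theorem anchoredDoorHitsLowerPairs_of_ltRest (hR : Stmt.stub_ltRest) :
    Summit.ValiantsHypothesis.ValiantsHypothesis.Theses.BarrierLever.AnchoredDoorHitsLowerPairs :=
  anchoredDoorHitsLowerPairs_of_relApexRest (stub_relApexRest_of_ltRest hR)

end

end Summit.ValiantsHypothesis.ValiantsHypothesis.Theorems.BarrierLever.AnchoredPeeling
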